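import Summits.Ventures.YMGap.RobustBall.FreeEnergyLawTorus
import Summits.Ventures.YMGap.RobustBall.FreeEnergyLaw
import Summits.Ventures.YMGap.RobustBall.BoundaryDecayTorus
import Summits.Ventures.YMGap.Thresholds.PressureTwoSided
import Summits.Ventures.YMGap.Thresholds.PressureDerivativeSUN
import HarnessLib

/-!
# Venture YMGap, track ROBUST-BALL — «C-FSS»: EXPONENTIALLY SMALL FINITE-SIZE CORRECTIONS OF THE PERIODIC FREE ENERGY,
# `SU(2)` lattice Yang–Mills on `(ℤ/L)⁴`, EVERY `|β_W| ≤ 1/9` (and every `N ≥ 2` at 't Hooft `0 ≤ β < 1/48`)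

HONEST FRAMING. WHAT THIS IS: a venture file (cell `pub-ymgap`, track Y2 ROBUST-BALL / DS, seat ds-3, theorems only, 0 compute).
Strong-coupling LATTICE statements comparing the free energy per site of the periodic Wilson theory on the torus `(ℤ/(L+1))⁴`,
`|Λ_{L+1}|⁻¹ log Z_{Λ_{L+1}, b}` (tree `torusLogPartition 4 ρ b (L+1)`), with its thermodynamic limit `f(b) = freeEnergyDensity 4 ρ b`:
* ★★★ `su2_abs_torusPressure_sub_freeEnergyDensity_le` — `SU(2)`, tree coupling `|b| ≤ 1/18` (TWO-SIDED, `|β_W| ≤ 1/9`), every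
  `1 ≤ n` with `2(n+1) < L+1`: `| |Λ_{L+1}|⁻¹ log Z_{Λ_{L+1}, b} − f(b) | ≤ |b| · 3072√2 · 2^{−(n−1)}`;
  ★★★ `su2_abs_torusPressure_sub_freeEnergyDensity_le_of_le` — for every `L ≥ 4`: `≤ |b| · 3072√2 · 2^{−⌊(L−4)/2⌋}`: the finite-size
  correction of the periodic free energy is EXPONENTIALLY SMALL IN THE SIDE LENGTH (no surface term on a torus), with ONE explicit
  constant on the whole window;
* ★ `suN_abs_torusPressure_sub_freeEnergyDensity_le` — EVERY `N ≥ 2`, `d = 4`, 't Hooft `0 ≤ β < 1/48` (tree coupling `N β`), ratio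
  `max(ρ, ½)` for any `ρ ∈ [18β/(½ − 6β), 1)`: `≤ N β · 192 N⁴√N · max(ρ,½)^{n−1}` (rb-p1's Bakry–Émery door through the seat's
  `suN_wilson_torus_dim4`, ds-1's every-`N` `f′`).
MECHANISM: `d/ds (|Λ|⁻¹ log Z_{Λ,s} − f(s)) = Σ_{i<j} (⟨Re tr U_{(0;i,j)}⟩_{Λ,s} − μ_s(Re tr U_{(0;i,j)}))` — rb-p2's
`FreeEnergyLaw.hasDerivAt_torusPressure` (translation invariance of the torus state) against ds-1's thermodynamic identity
`f′(s) = −Σ_{i<j}(N − μ_s(Re tr U_{ij}))` (`PressureRegularity.su2_hasDerivWithinAt_freeEnergyDensity_abs`, `…_SU_thooft`); each plane term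
is exponentially small in the torus side by the seat's torus one-state rate (`su2_wilson_torus_abs_le_oneNinth`: `2√2·K·#Δ·2^{−(n−m)}` for
Lipschitz cylinders based in `[−m,m]⁴`, torus side `> 2(n+1)`); the mean value inequality between `0` and `b` and `log Z_{Λ,0} = f(0) = 0`.
WHAT THIS IS NOT: lattice strong coupling only; the rate `2^{−L/2}` is a Dobrushin-comparison artefact (the true rate is the mass gap);
nothing about the continuum limit, a spectral gap or the Clay Millennium problem.
References: M. E. Fisher, in *Critical Phenomena* (1971) (finite-size corrections; statement type); S. Friedli, Y. Velenik (2017)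
§3.2–3.3; the tree files named above. Everything here is proved. [folklore]
-/

noncomputable section

open MeasureTheory ProbabilityTheory Filter Topology Real Finset Set
open scoped NNReal
open Literature.Probability.LatticeModels hiding configShift configShift_apply
open Literature.MathematicalPhysics.QuantumLattice
open Literature.MathematicalPhysics.QuantumFieldTheory (IsLipschitzCylinder isLipschitzCylinder_zdPlaquetteObs zdPlaquetteObs
  wilsonExpectation card_plaquetteEdges_le)
open Summit.Ventures.YMGap.CouplingResponse (plaquetteObs_fundamentalRep_eq_mul_zdPlaquetteObs)

namespace Summit.Ventures.YMGap.RobustBall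

namespace TorusFreeEnergyRate

variable {N : ℕ}

/-- The four links of the plaquette `(0; i<j)` are based in the box `[−1, 1]⁴`. [folklore] -/
theorem plaquetteEdges_zero_subset_boxLinks {i j : Fin 4} (hij : i < j) :
    plaquetteEdges (((0 : Site 4), ⟨(i, j), hij⟩) : ZdPlaquette 4) ⊆ boxLinks 4 1 := by
  intro e he
  rw [mem_boxLinks, mem_siteBox_iff_norm]
  simp only [plaquetteEdges, Finset.mem_insert, Finset.mem_singleton, zero_add] at he
  rcases he with rfl | rfl | rfl | rfl
  · simp
  · rw [Pi.norm_single]; simp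
  · rw [Pi.norm_single]; simp
  · simp

/-- `log Z_{Λ_{L+1}, 0} = 0`, in the per-site form used below. [folklore] -/
theorem torusPressure_zero (hρN : Continuous (fundamentalRep (Fin N))) (L : ℕ) :
    (((L + 1 : ℕ) : ℝ) ^ 4)⁻¹ * torusLogPartition 4 (fundamentalRep (Fin N)) 0 (L + 1) = 0 := by
  rw [FreeEnergyLaw.torusPressure_eq_integral (d := 4) (fundamentalRep (Fin N)) hρN L 0, intervalIntegral.integral_same]
  ring

/-! ### `SU(2)`, two-sided window `|β_W| ≤ 1/9` -/

/-- **Per-plane torus error**: for `|s| ≤ 1/18`, a DLR state `μ` at `s`, `1 ≤ n`, torus side `L > 2(n+1)` and a plane `i < j`: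
`|⟨Re tr U_{(0;i,j)}⟩_{(ℤ/L)⁴, s} − μ(Re tr U_{(0;i,j)})| ≤ 512√2 · 2^{−(n−1)}` (the seat's `su2_wilson_torus_abs_le_oneNinth` on the normalised
plaquette, a Lipschitz cylinder of constant `32` based in `[−1,1]⁴`). [folklore] -/
theorem su2_abs_torus_plaquette_sub_le {s : ℝ} (hs : |s| ≤ 1 / 18)
    {μ : Measure (LGConfig 4 (Matrix.specialUnitaryGroup (Fin 2) ℂ))}
    (hμ : μ ∈ ymGibbsMeasures (d := 4) (fundamentalRep (Fin 2)) s) {n L : ℕ} [NeZero L] (hn : 1 ≤ n) (hL : 2 * (n + 1) < L)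
    {i j : Fin 4} (hij : i < j) :
    |wilsonExpectation (fundamentalRep (Fin 2)) s (toTorusObservable L (plaquetteObs (fundamentalRep (Fin 2)) (0 : Site 4) i j)) -
        ∫ U, plaquetteObs (fundamentalRep (Fin 2)) 0 i j U ∂μ| ≤ 512 * Real.sqrt 2 * (1 / 2 : ℝ) ^ (n - 1) := by
  have hF := isLipschitzCylinder_zdPlaquetteObs (d := 4) (N := 2) (0 : Site 4) hij
  have hβ : |2 * s| ≤ 1 / 9 := by rw [abs_mul, abs_two]; linarith
  have hμ' : μ ∈ ymGibbsMeasures (d := 4) (fundamentalRep (Fin 2)) (2 * s / 2) := by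
    rwa [show (2 : ℝ) * s / 2 = s by ring]
  have key := su2_wilson_torus_abs_le_oneNinth hβ hμ' hn hL hF (plaquetteEdges_zero_subset_boxLinks hij)
  rw [show (2 : ℝ) * s / 2 = s by ring] at key
  have hcard : ((plaquetteEdges (((0 : Site 4), ⟨(i, j), hij⟩) : ZdPlaquette 4)).card : ℝ) ≤ 4 := by
    exact_mod_cast card_plaquetteEdges_le _
  -- `Re tr = 2 · W̄` on the torus side and on the DLR side
  have hT : wilsonExpectation (fundamentalRep (Fin 2)) s (toTorusObservable L (plaquetteObs (fundamentalRep (Fin 2)) (0 : Site 4) i j)) =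
      2 * wilsonExpectation (fundamentalRep (Fin 2)) s
        (toTorusObservable L (zdPlaquetteObs (d := 4) (fundamentalRep (Fin 2)) (0 : Site 4) i j)) := by
    unfold wilsonExpectation
    rw [← integral_const_mul]
    refine integral_congr_ae (ae_of_all _ fun V => ?_)
    simp only [toTorusObservable, Function.comp_apply]
    rw [plaquetteObs_fundamentalRep_eq_mul_zdPlaquetteObs]; norm_num
  have hD : (∫ U, plaquetteObs (fundamentalRep (Fin 2)) 0 i j U ∂μ) =
      2 * ∫ U, zdPlaquetteObs (d := 4) (fundamentalRep (Fin 2)) (0 : Site 4) i j U ∂μ := by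
    rw [← integral_const_mul]
    refine integral_congr_ae (ae_of_all _ fun U => ?_)
    rw [plaquetteObs_fundamentalRep_eq_mul_zdPlaquetteObs]; norm_num
  have hq : (0 : ℝ) ≤ (1 / 2 : ℝ) ^ (n - 1) := by positivity
  rw [hT, hD, ← mul_sub, abs_mul, abs_two]
  calc 2 * |wilsonExpectation (fundamentalRep (Fin 2)) s
            (toTorusObservable L (zdPlaquetteObs (d := 4) (fundamentalRep (Fin 2)) (0 : Site 4) i j)) -
          ∫ U, zdPlaquetteObs (d := 4) (fundamentalRep (Fin 2)) (0 : Site 4) i j U ∂μ|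
      ≤ 2 * (2 * Real.sqrt 2 * ((4 * (2 : ℝ≥0) ^ 3 : ℝ≥0) : ℝ) *
          (plaquetteEdges (((0 : Site 4), ⟨(i, j), hij⟩) : ZdPlaquette 4)).card * (1 / 2 : ℝ) ^ (n - 1)) :=
        mul_le_mul_of_nonneg_left key (by norm_num)
    _ ≤ 2 * (2 * Real.sqrt 2 * ((4 * (2 : ℝ≥0) ^ 3 : ℝ≥0) : ℝ) * 4 * (1 / 2 : ℝ) ^ (n - 1)) := by gcongr
    _ = 512 * Real.sqrt 2 * (1 / 2 : ℝ) ^ (n - 1) := by push_cast; ring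

/-- ★★★ **«C-FSS»: EXPONENTIALLY SMALL FINITE-SIZE CORRECTIONS OF THE PERIODIC FREE ENERGY** (`SU(2)`, `d = 4`, Wilson action, tree
coupling `|b| ≤ 1/18`, i.e. EVERY `|β_W| ≤ 1/9`, two-sided). For every `1 ≤ n` and every torus side `L + 1 > 2(n+1)`:
`| |Λ_{L+1}|⁻¹ log Z_{Λ_{L+1}, b} − f(b) | ≤ |b| · 3072√2 · (1/2)^{n−1}`, `f = freeEnergyDensity 4 ρ` the infinite-volume free energy per site.
[folklore] -/
theorem su2_abs_torusPressure_sub_freeEnergyDensity_le {b : ℝ} (hb : |b| ≤ 1 / 18) {n L : ℕ} (hn : 1 ≤ n)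
    (hL : 2 * (n + 1) < L + 1) :
    |(((L + 1 : ℕ) : ℝ) ^ 4)⁻¹ * torusLogPartition 4 (fundamentalRep (Fin 2)) b (L + 1) - freeEnergyDensity 4 (fundamentalRep (Fin 2)) b| ≤
      |b| * (3072 * Real.sqrt 2 * (1 / 2 : ℝ) ^ (n - 1)) := by
  have hρc : Continuous (fundamentalRep (Fin 2)) := continuous_fundamentalRep (Fin 2)
  set C : ℝ := 3072 * Real.sqrt 2 * (1 / 2 : ℝ) ^ (n - 1) with hC
  set P : ℝ → ℝ := fun s => (((L + 1 : ℕ) : ℝ) ^ 4)⁻¹ * torusLogPartition 4 (fundamentalRep (Fin 2)) s (L + 1) with hP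
  set f : ℝ → ℝ := freeEnergyDensity 4 (fundamentalRep (Fin 2)) with hf
  set D : ℝ → ℝ := fun s => P s - f s with hD
  obtain ⟨ν, hν⟩ := PressureRegularity.su2_exists_dlrSelection_tree
  -- the derivative of `D` on the window is the plane sum of the torus errors
  have hDer : ∀ s ∈ Icc (-(9 / 50) : ℝ) (9 / 50), HasDerivWithinAt D
      (∑ q : {q : Fin 4 × Fin 4 // q.1 < q.2},
        (wilsonExpectation (fundamentalRep (Fin 2)) s
            (toTorusObservable (L + 1) (plaquetteObs (fundamentalRep (Fin 2)) (0 : Site 4) q.1.1 q.1.2)) -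
          ∫ U, plaquetteObs (fundamentalRep (Fin 2)) 0 q.1.1 q.1.2 U ∂(ν s))) (Icc (-(9 / 50) : ℝ) (9 / 50)) s := by
    intro s hs
    have h1 := (FreeEnergyLaw.hasDerivAt_torusPressure (d := 4) (fundamentalRep (Fin 2)) hρc L s).hasDerivWithinAt
      (s := Icc (-(9 / 50) : ℝ) (9 / 50))
    have h2 := PressureRegularity.su2_hasDerivWithinAt_freeEnergyDensity_abs (fun β _ => hν β) hs
    refine (h1.fun_sub h2).congr_deriv ?_
    rw [Finset.sum_sub_distrib, Finset.sum_sub_distrib, Finset.sum_const, Finset.card_univ,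
      show Fintype.card {q : Fin 4 × Fin 4 // q.1 < q.2} = 6 from by decide, nsmul_eq_mul]
    push_cast
    ring
  -- the derivative is bounded by `C` between `0` and `b`
  have hsub : uIcc (0 : ℝ) b ⊆ Icc (-(9 / 50) : ℝ) (9 / 50) := fun s hs => by
    have h := abs_sub_left_of_mem_uIcc hs
    rw [sub_zero, sub_zero] at h
    have h' : |s| ≤ 1 / 18 := h.trans hb
    constructor <;> linarith [abs_le.1 h']
  have hD' : ∀ s ∈ uIcc (0 : ℝ) b,
      ‖∑ q : {q : Fin 4 × Fin 4 // q.1 < q.2},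
        (wilsonExpectation (fundamentalRep (Fin 2)) s
            (toTorusObservable (L + 1) (plaquetteObs (fundamentalRep (Fin 2)) (0 : Site 4) q.1.1 q.1.2)) -
          ∫ U, plaquetteObs (fundamentalRep (Fin 2)) 0 q.1.1 q.1.2 U ∂(ν s))‖ ≤ C := by
    intro s hs
    have h := abs_sub_left_of_mem_uIcc hs
    rw [sub_zero, sub_zero] at h
    have hs' : |s| ≤ 1 / 18 := h.trans hb
    rw [Real.norm_eq_abs]
    refine (Finset.abs_sum_le_sum_abs _ _).trans ?_
    calc ∑ q : {q : Fin 4 × Fin 4 // q.1 < q.2},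
          |wilsonExpectation (fundamentalRep (Fin 2)) s
              (toTorusObservable (L + 1) (plaquetteObs (fundamentalRep (Fin 2)) (0 : Site 4) q.1.1 q.1.2)) -
            ∫ U, plaquetteObs (fundamentalRep (Fin 2)) 0 q.1.1 q.1.2 U ∂(ν s)|
        ≤ ∑ _q : {q : Fin 4 × Fin 4 // q.1 < q.2}, 512 * Real.sqrt 2 * (1 / 2 : ℝ) ^ (n - 1) :=
          Finset.sum_le_sum fun q _ => su2_abs_torus_plaquette_sub_le hs' (hν s) hn hL q.2
      _ = C := by
          rw [Finset.sum_const, Finset.card_univ, show Fintype.card {q : Fin 4 × Fin 4 // q.1 < q.2} = 6 from by decide,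
            nsmul_eq_mul, hC]
          push_cast
          ring
  -- the mean value inequality between `0` and `b`
  have hMVT := Convex.norm_image_sub_le_of_norm_hasDerivWithin_le (f := D) (s := uIcc (0 : ℝ) b)
    (fun s hs => (hDer s (hsub hs)).mono hsub) hD' (convex_uIcc 0 b) left_mem_uIcc right_mem_uIcc
  -- `D 0 = 0`
  have hf0 : f 0 = 0 := by
    have h := FreeEnergyLaw.freeEnergyDensity_two_sided (d := 4) (fundamentalRep (Fin 2))
      (Literature.MathematicalPhysics.QuantumFieldTheory.TorusAreaLaw.isSpecialUnitaryModel_fundamentalRep 2) le_rfl (by norm_num)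
      (le_refl (0 : ℝ))
    simp only [mul_zero, zero_pow two_ne_zero, zero_div, add_zero, neg_zero, Real.exp_zero, mul_one] at h
    exact le_antisymm h.2 h.1
  have hD0 : D 0 = 0 := by
    show P 0 - f 0 = 0
    rw [hf0, sub_zero]
    exact torusPressure_zero hρc L
  rw [hD0, sub_zero, sub_zero, Real.norm_eq_abs, Real.norm_eq_abs] at hMVT
  calc |D b| ≤ C * |b| := hMVT
    _ = |b| * C := mul_comm _ _

/-- ★★★ **The same with the exponent in the side length**: for `|b| ≤ 1/18` and every `L ≥ 4`,
`| |Λ_{L+1}|⁻¹ log Z_{Λ_{L+1}, b} − f(b) | ≤ |b| · 3072√2 · (1/2)^{⌊(L−4)/2⌋}` — the periodic free energy per site converges to its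
thermodynamic limit EXPONENTIALLY FAST in the side of the torus, with one explicit constant on the whole window `|β_W| ≤ 1/9`. [folklore] -/
theorem su2_abs_torusPressure_sub_freeEnergyDensity_le_of_le {b : ℝ} (hb : |b| ≤ 1 / 18) {L : ℕ} (hL : 4 ≤ L) :
    |(((L + 1 : ℕ) : ℝ) ^ 4)⁻¹ * torusLogPartition 4 (fundamentalRep (Fin 2)) b (L + 1) - freeEnergyDensity 4 (fundamentalRep (Fin 2)) b| ≤
      |b| * (3072 * Real.sqrt 2 * (1 / 2 : ℝ) ^ ((L - 4) / 2)) := by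
  have h := su2_abs_torusPressure_sub_freeEnergyDensity_le hb (n := (L - 2) / 2) (L := L) (by omega) (by omega)
  rwa [show (L - 2) / 2 - 1 = (L - 4) / 2 by omega] at h

/-! ### Every `N ≥ 2`, `d = 4`, 't Hooft `0 ≤ β < 1/48` -/

/-- **Per-plane torus error, every `N ≥ 2`** ('t Hooft `|β| < 1/48`, tree coupling `N β`, ratio `max(ρ,½)`, `ρ ≥ 18|β|/(½ − 6|β|)`, `ρ < 1`):
`|⟨Re tr U_{(0;i,j)}⟩_{(ℤ/L)⁴} − μ(Re tr U_{(0;i,j)})| ≤ 32 N⁴ √N · max(ρ,½)^{n−1}` for `1 ≤ n`, `L > 2(n+1)`. [folklore] -/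
theorem suN_abs_torus_plaquette_sub_le (hN : 2 ≤ N) {β ρ : ℝ} (hβ : |β| < 1 / 48)
    (hρ : 18 * |β| / (1 / 2 - 6 * |β|) ≤ ρ) (hρ1 : ρ < 1)
    {μ : Measure (LGConfig 4 (Matrix.specialUnitaryGroup (Fin N) ℂ))}
    (hμ : μ ∈ ymGibbsMeasures (d := 4) (fundamentalRep (Fin N)) (N * β)) {n L : ℕ} [NeZero L] (hn : 1 ≤ n)
    (hL : 2 * (n + 1) < L) {i j : Fin 4} (hij : i < j) :
    |wilsonExpectation (fundamentalRep (Fin N)) (N * β)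
          (toTorusObservable L (plaquetteObs (fundamentalRep (Fin N)) (0 : Site 4) i j)) -
        ∫ U, plaquetteObs (fundamentalRep (Fin N)) 0 i j U ∂μ| ≤
      32 * (N : ℝ) ^ 4 * Real.sqrt N * (max ρ (1 / 2)) ^ (n - 1) := by
  have hF := isLipschitzCylinder_zdPlaquetteObs (d := 4) (N := N) (0 : Site 4) hij
  have key := suN_wilson_torus_dim4 hN hβ hρ hρ1 hμ hn hL hF (plaquetteEdges_zero_subset_boxLinks hij)
  have hcard : ((plaquetteEdges (((0 : Site 4), ⟨(i, j), hij⟩) : ZdPlaquette 4)).card : ℝ) ≤ 4 := by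
    exact_mod_cast card_plaquetteEdges_le _
  have hN0 : (0 : ℝ) ≤ N := Nat.cast_nonneg N
  have hT : wilsonExpectation (fundamentalRep (Fin N)) (N * β)
        (toTorusObservable L (plaquetteObs (fundamentalRep (Fin N)) (0 : Site 4) i j)) =
      N * wilsonExpectation (fundamentalRep (Fin N)) (N * β)
        (toTorusObservable L (zdPlaquetteObs (d := 4) (fundamentalRep (Fin N)) (0 : Site 4) i j)) := by
    unfold wilsonExpectation
    rw [← integral_const_mul]
    refine integral_congr_ae (ae_of_all _ fun V => ?_)
    simp only [toTorusObservable, Function.comp_apply]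
    rw [plaquetteObs_fundamentalRep_eq_mul_zdPlaquetteObs]
  have hD : (∫ U, plaquetteObs (fundamentalRep (Fin N)) 0 i j U ∂μ) =
      N * ∫ U, zdPlaquetteObs (d := 4) (fundamentalRep (Fin N)) (0 : Site 4) i j U ∂μ := by
    rw [← integral_const_mul]
    exact integral_congr_ae (ae_of_all _ fun U => plaquetteObs_fundamentalRep_eq_mul_zdPlaquetteObs _ _ _ U)
  have hq : (0 : ℝ) ≤ (max ρ (1 / 2)) ^ (n - 1) := pow_nonneg (le_max_of_le_right (by norm_num)) _
  rw [hT, hD, ← mul_sub, abs_mul, Nat.abs_cast]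
  calc (N : ℝ) * |wilsonExpectation (fundamentalRep (Fin N)) (N * β)
            (toTorusObservable L (zdPlaquetteObs (d := 4) (fundamentalRep (Fin N)) (0 : Site 4) i j)) -
          ∫ U, zdPlaquetteObs (d := 4) (fundamentalRep (Fin N)) (0 : Site 4) i j U ∂μ|
      ≤ N * (2 * Real.sqrt N * ((4 * (N : ℝ≥0) ^ 3 : ℝ≥0) : ℝ) *
          (plaquetteEdges (((0 : Site 4), ⟨(i, j), hij⟩) : ZdPlaquette 4)).card * (max ρ (1 / 2)) ^ (n - 1)) :=
        mul_le_mul_of_nonneg_left key hN0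
    _ ≤ N * (2 * Real.sqrt N * ((4 * (N : ℝ≥0) ^ 3 : ℝ≥0) : ℝ) * 4 * (max ρ (1 / 2)) ^ (n - 1)) := by gcongr
    _ = 32 * (N : ℝ) ^ 4 * Real.sqrt N * (max ρ (1 / 2)) ^ (n - 1) := by push_cast; ring

/-- ★ **«C-FSS», every `N ≥ 2`**: `d = 4`, Wilson action, 't Hooft `0 ≤ β < 1/48` (tree coupling `N β`), ratio `max(ρ,½)` with
`18β/(½ − 6β) ≤ ρ < 1`, every `1 ≤ n`, torus side `L + 1 > 2(n+1)`:
`| |Λ_{L+1}|⁻¹ log Z_{Λ_{L+1}, Nβ} − f(Nβ) | ≤ N β · 192 N⁴ √N · max(ρ,½)^{n−1}` — HYPOTHESIS-FREE (rb-p1's Bakry–Émery door, ds-1's every-`N`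
thermodynamic identity). [folklore] -/
theorem suN_abs_torusPressure_sub_freeEnergyDensity_le (hN : 2 ≤ N) {β ρ : ℝ} (hβ0 : 0 ≤ β) (hβ : β < 1 / 48)
    (hρ : 18 * β / (1 / 2 - 6 * β) ≤ ρ) (hρ1 : ρ < 1) {n L : ℕ} (hn : 1 ≤ n) (hL : 2 * (n + 1) < L + 1) :
    |(((L + 1 : ℕ) : ℝ) ^ 4)⁻¹ * torusLogPartition 4 (fundamentalRep (Fin N)) (N * β) (L + 1) -
        freeEnergyDensity 4 (fundamentalRep (Fin N)) (N * β)| ≤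
      N * β * (192 * (N : ℝ) ^ 4 * Real.sqrt N * (max ρ (1 / 2)) ^ (n - 1)) := by
  have hρc : Continuous (fundamentalRep (Fin N)) := continuous_fundamentalRep (Fin N)
  have hN0 : (0 : ℝ) < N := by exact_mod_cast (show 0 < N by omega)
  set C : ℝ := 192 * (N : ℝ) ^ 4 * Real.sqrt N * (max ρ (1 / 2)) ^ (n - 1) with hC
  set P : ℝ → ℝ := fun s => (((L + 1 : ℕ) : ℝ) ^ 4)⁻¹ * torusLogPartition 4 (fundamentalRep (Fin N)) s (L + 1) with hP
  set f : ℝ → ℝ := freeEnergyDensity 4 (fundamentalRep (Fin N)) with hf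
  set D : ℝ → ℝ := fun s => P s - f s with hD
  -- the window of ds-1's every-`N` identity contains `[0, N β]`
  have hwin : (N : ℝ) * β ≤ (N : ℝ) * (9 / 308) := mul_le_mul_of_nonneg_left (by linarith) hN0.le
  -- a DLR selection on the closed window (the one state), junk elsewhere
  have hex : ∀ s : ℝ, ∃ ν : Measure (LGConfig 4 (Matrix.specialUnitaryGroup (Fin N) ℂ)),
      s ∈ Icc (0 : ℝ) ((N : ℝ) * (9 / 308)) → ν ∈ ymGibbsMeasures (d := 4) (fundamentalRep (Fin N)) s := by
    intro s
    by_cases hs : s ∈ Icc (0 : ℝ) ((N : ℝ) * (9 / 308))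
    · haveI : SecondCountableTopology (Matrix.specialUnitaryGroup (Fin N) ℂ) :=
        haveI : SecondCountableTopology (Matrix (Fin N) (Fin N) ℂ) :=
          inferInstanceAs (SecondCountableTopology (Fin N → Fin N → ℂ))
        Topology.IsEmbedding.subtypeVal.secondCountableTopology
      obtain ⟨ν, hν⟩ := Literature.MathematicalPhysics.QuantumFieldTheory.ymGibbsMeasures_nonempty (d := 4)
        (fundamentalRep (Fin N)) hρc s
      exact ⟨ν, fun _ => hν⟩
    · exact ⟨0, fun h => absurd h hs⟩
  choose ν hν using hex
  have hDer : ∀ s ∈ Icc (0 : ℝ) ((N : ℝ) * (9 / 308)), HasDerivWithinAt D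
      (∑ q : {q : Fin 4 × Fin 4 // q.1 < q.2},
        (wilsonExpectation (fundamentalRep (Fin N)) s
            (toTorusObservable (L + 1) (plaquetteObs (fundamentalRep (Fin N)) (0 : Site 4) q.1.1 q.1.2)) -
          ∫ U, plaquetteObs (fundamentalRep (Fin N)) 0 q.1.1 q.1.2 U ∂(ν s))) (Icc (0 : ℝ) ((N : ℝ) * (9 / 308))) s := by
    intro s hs
    have h1 := (FreeEnergyLaw.hasDerivAt_torusPressure (d := 4) (fundamentalRep (Fin N)) hρc L s).hasDerivWithinAt
      (s := Icc (0 : ℝ) ((N : ℝ) * (9 / 308)))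
    have h2 := PressureRegularity.hasDerivWithinAt_freeEnergyDensity_SU_thooft hN hν hs
    refine (h1.fun_sub h2).congr_deriv ?_
    rw [Finset.sum_sub_distrib, Finset.sum_sub_distrib, Finset.sum_const, Finset.card_univ, nsmul_eq_mul]
    ring
  have hsub : Icc (0 : ℝ) (N * β) ⊆ Icc (0 : ℝ) ((N : ℝ) * (9 / 308)) := Icc_subset_Icc_right hwin
  have hD' : ∀ s ∈ Icc (0 : ℝ) (N * β),
      ‖∑ q : {q : Fin 4 × Fin 4 // q.1 < q.2},
        (wilsonExpectation (fundamentalRep (Fin N)) s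
            (toTorusObservable (L + 1) (plaquetteObs (fundamentalRep (Fin N)) (0 : Site 4) q.1.1 q.1.2)) -
          ∫ U, plaquetteObs (fundamentalRep (Fin N)) 0 q.1.1 q.1.2 U ∂(ν s))‖ ≤ C := by
    intro s hs
    -- `s = N β'` with `|β'| < 1/48` and the ratio still `≥ 18|β'|/(½ − 6|β'|)`
    set β' : ℝ := s / N with hβ'
    have hsN : (N : ℝ) * β' = s := by rw [hβ']; field_simp
    have hβ'0 : 0 ≤ β' := by rw [hβ']; exact div_nonneg hs.1 hN0.le
    have hβ'le : β' ≤ β := by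
      rw [hβ', div_le_iff₀ hN0]; linarith [hs.2]
    have hβ'a : |β'| < 1 / 48 := by rw [abs_of_nonneg hβ'0]; linarith
    have hρ' : 18 * |β'| / (1 / 2 - 6 * |β'|) ≤ ρ := by
      rw [abs_of_nonneg hβ'0]
      refine le_trans ?_ hρ
      have h1 : 0 < 1 / 2 - 6 * β := by linarith
      have h2 : 0 < 1 / 2 - 6 * β' := by linarith
      rw [div_le_div_iff₀ h2 h1]
      nlinarith
    have hμs : ν s ∈ ymGibbsMeasures (d := 4) (fundamentalRep (Fin N)) (N * β') := by rw [hsN]; exact hν s (hsub hs)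
    rw [Real.norm_eq_abs]
    refine (Finset.abs_sum_le_sum_abs _ _).trans ?_
    calc ∑ q : {q : Fin 4 × Fin 4 // q.1 < q.2},
          |wilsonExpectation (fundamentalRep (Fin N)) s
              (toTorusObservable (L + 1) (plaquetteObs (fundamentalRep (Fin N)) (0 : Site 4) q.1.1 q.1.2)) -
            ∫ U, plaquetteObs (fundamentalRep (Fin N)) 0 q.1.1 q.1.2 U ∂(ν s)|
        ≤ ∑ _q : {q : Fin 4 × Fin 4 // q.1 < q.2}, 32 * (N : ℝ) ^ 4 * Real.sqrt N * (max ρ (1 / 2)) ^ (n - 1) :=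
          Finset.sum_le_sum fun q _ => by
            have h := suN_abs_torus_plaquette_sub_le hN hβ'a hρ' hρ1 hμs hn hL q.2
            rwa [hsN] at h
      _ = C := by
          rw [Finset.sum_const, Finset.card_univ, show Fintype.card {q : Fin 4 × Fin 4 // q.1 < q.2} = 6 from by decide,
            nsmul_eq_mul, hC]
          push_cast
          ring
  have hNβ : 0 ≤ (N : ℝ) * β := by positivity
  have hMVT := Convex.norm_image_sub_le_of_norm_hasDerivWithin_le (f := D) (s := Icc (0 : ℝ) (N * β))
    (fun s hs => (hDer s (hsub hs)).mono hsub) hD' (convex_Icc _ _) (left_mem_Icc.2 hNβ) (right_mem_Icc.2 hNβ)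
  have hf0 : f 0 = 0 := by
    have h := FreeEnergyLaw.freeEnergyDensity_two_sided (d := 4) (fundamentalRep (Fin N))
      (Literature.MathematicalPhysics.QuantumFieldTheory.TorusAreaLaw.isSpecialUnitaryModel_fundamentalRep N) hN (by norm_num)
      (le_refl (0 : ℝ))
    simp only [mul_zero, zero_pow two_ne_zero, zero_div, add_zero, neg_zero, Real.exp_zero, mul_one] at h
    exact le_antisymm h.2 h.1
  have hD0 : D 0 = 0 := by
    show P 0 - f 0 = 0
    rw [hf0, sub_zero]
    exact torusPressure_zero hρc L
  rw [hD0, sub_zero, sub_zero, Real.norm_eq_abs, Real.norm_eq_abs, abs_of_nonneg hNβ] at hMVT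
  calc |D (N * β)| ≤ C * (N * β) := hMVT
    _ = N * β * C := mul_comm _ _

end TorusFreeEnergyRate

end Summit.Ventures.YMGap.RobustBall

end
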